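import Summits.HodgeConjecture.HodgeConjecture.Theorems.AnchorTransportAnchorExistenceSplit
import Literature.AlgebraicGeometry.Motives.AbelianVarietyProjectiveChart
import HarnessLib

/-!
# Route AnchorTransport — `AnchorExistence` (item stmt-HodgeConjecture-1077): the three-sector split (K3 squares · abelian varieties · residual)

Crux-strategist glue (wall-breaker seat `cstrat-stmt-HodgeConjecture-1077-p1`, 2026-08-17) for the
route edit `--split AnchorExistence --into AnchorExistenceK3Square AnchorExistenceAbelian
AnchorExistenceResidual --glue-by anchorExistence_of_k3Square_of_abelian_of_residual`.

The crux `AnchorExistence` (every rational `(p,p)`-class on a smooth projective `X` is, up to an iso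
`X ≅ 𝒳_{s₁}`, the restriction of a fibrewise rational `(p,p)` class on the total space of a smooth
projective family over a smooth irreducible base, algebraic on some fibre) is concluded BY NAME from
three sector statements spelled out verbatim as hypotheses:

* `hK3` — the **K3-square sector** (`p = 2` on `S ⊗ S`, `S` a projective K3 surface): the sector the
  dead line `Sketch` closes modulo five named K3 facts and the real-multiplication construction
  (`anchorExistence_k3SquareSector_of_leaves`);
* `hAb` — the **abelian sector**: every rational `(p,p)`-class on (the underlying scheme of) a complex
  abelian variety `A` is anchored, in relative dimension `A.dim`.  This is the second sector in which
  the anchor mechanism has content separable from the Hodge conjecture: Hodge loci of abelian schemes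
  are special subvarieties of Siegel modular varieties, on which CM points are dense, so an anchor is a
  CM abelian variety and the sector reduces to the algebraicity of Weil classes on CM abelian varieties
  of Weil type (Deligne 1982 / André 1992; Markman 2025 for fourfolds and split sixfolds);
* `hres` — the **residual sector**: `X` in the middle range `2 ≤ p ≤ n − 2`, NOT isomorphic to a K3
  square and NOT isomorphic to an abelian variety, `c` not already algebraic.  By the landed tightness
  lemma `anchorTransport_mem_algebraicClasses_of_anchor_of_fiberIso` and `Negative/ConstantClause` this
  is the anchor GEOGRAPHY of genuine deformations, and on An-rigid pairs (squares of rigid Calabi–Yau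
  threefolds, compact ball quotients, isolated Hodge-locus points) it is the Hodge conjecture verbatim —
  the certified wall on which the lines `Sketch` and `Sketch-peel-to-zero` died.

The proof refines the landed two-sector glue `anchorExistence_of_k3Square_of_offK3Square`: off K3
squares, if `X ≅ A.X` for an abelian variety `A` then `n = A.dim` (abelian varieties are smooth
projective of dimension `A.dim`, `AbelianVariety.isSmoothProjective_holds`, and the dimension is an iso
invariant, `anchorExistenceSplit_dim_eq_of_iso`), the anchor of `(A.X, (g⁻¹)^* c)` given by `hAb`
transports along `g` (`anchorTransport_anchor_map_of_iso`); otherwise `hres` applies.  The split is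
LOSSLESS (`anchorExistence_iff_k3Square_and_abelian_and_residual`): each sector is an instance of the
crux, so the three children are jointly equivalent to the parent.
-/

noncomputable section

set_option linter.dupNamespace false

open CategoryTheory AlgebraicGeometry MonoidalCategory
open Literature.AlgebraicGeometry Literature.AlgebraicGeometry.Motives
  Literature.AlgebraicGeometry.HodgeTheory Literature.AlgebraicGeometry.Surfaces

namespace Summit.HodgeConjecture.HodgeConjecture.Theorems

open Summit.HodgeConjecture.HodgeConjecture.Theses.AnchorTransport

/-- **`AnchorExistence` from its three sectors** (typed split of the crux, kernel-checked glue):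
(`hK3`) every rational `(2,2)`-class on the square of a projective K3 surface is anchored; (`hAb`)
every rational `(p,p)`-class on a complex abelian variety is anchored; (`hres`) in the middle range
`2 ≤ p ≤ n − 2`, off K3 squares and off abelian varieties, every rational `(p,p)`-class which is not
already algebraic is anchored.  Then the crux `AnchorExistence` holds: the two-sector glue
`anchorExistence_of_k3Square_of_offK3Square` (Lefschetz range by Lefschetz `(1,1)` + hard Lefschetz,
K3 squares by `hK3`, constant family for algebraic classes) leaves the off-K3-square complement, which
is `hAb` transported along `g : X ≅ A.X` (with `n = A.dim`) or `hres`.  The conclusion is literally the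
route decl. [cite: Deligne2000, §1] [cite: Deligne1982HodgeCycles, §4–§5] -/
theorem anchorExistence_of_k3Square_of_abelian_of_residual :
    (∀ S : SchemeOver ℂ, IsK3Surface S →
      ∀ c : complexBetti (S ⊗ S) (2 * 2), IsRationalClass c → IsOfHodgeType 4 (S ⊗ S) (2 * 2) 2 2 c →
      ∃ (𝒳 B : SchemeOver ℂ) (f : 𝒳 ⟶ B) (s₁ s₀ : ComplexPoints B) (e : S ⊗ S ≅ fiberOver f s₁)
        (A : complexBetti 𝒳 (2 * 2)),
        IsSmoothProjectiveFamily f 4 ∧ IrreducibleSpace B.left ∧ AlgebraicGeometry.Smooth B.hom ∧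
        (∀ s : ComplexPoints B, IsRationalClass (complexBetti.map (fiberι f s) (2 * 2) A) ∧
          IsOfHodgeType 4 (fiberOver f s) (2 * 2) 2 2 (complexBetti.map (fiberι f s) (2 * 2) A)) ∧
        complexBetti.map e.hom (2 * 2) (complexBetti.map (fiberι f s₁) (2 * 2) A) = c ∧
        complexBetti.map (fiberι f s₀) (2 * 2) A ∈ algebraicClasses (fiberOver f s₀) 2) →
    (∀ (A : AbelianVariety ℂ) (p : ℕ) (c : complexBetti A.X (2 * p)), IsRationalClass c →
      IsOfHodgeType A.dim A.X (2 * p) p p c →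
      ∃ (𝒳 S : SchemeOver ℂ) (f : 𝒳 ⟶ S) (s₁ s₀ : ComplexPoints S) (e : A.X ≅ fiberOver f s₁)
        (B : complexBetti 𝒳 (2 * p)),
        IsSmoothProjectiveFamily f A.dim ∧ IrreducibleSpace S.left ∧ AlgebraicGeometry.Smooth S.hom ∧
        (∀ s : ComplexPoints S, IsRationalClass (complexBetti.map (fiberι f s) (2 * p) B) ∧
          IsOfHodgeType A.dim (fiberOver f s) (2 * p) p p (complexBetti.map (fiberι f s) (2 * p) B)) ∧
        complexBetti.map e.hom (2 * p) (complexBetti.map (fiberι f s₁) (2 * p) B) = c ∧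
        complexBetti.map (fiberι f s₀) (2 * p) B ∈ algebraicClasses (fiberOver f s₀) p) →
    (∀ ⦃n : ℕ⦄ ⦃X : SchemeOver ℂ⦄, IsSmoothProjective n X →
      (∀ S : SchemeOver ℂ, IsK3Surface S → IsEmpty (X ≅ S ⊗ S)) →
      (∀ A : AbelianVariety ℂ, IsEmpty (X ≅ A.X)) →
      ∀ (p : ℕ), 2 ≤ p → p + 2 ≤ n →
      ∀ (c : complexBetti X (2 * p)), IsRationalClass c → IsOfHodgeType n X (2 * p) p p c →
      c ∉ algebraicClasses X p →
      ∃ (𝒳 S : SchemeOver ℂ) (f : 𝒳 ⟶ S) (s₁ s₀ : ComplexPoints S) (e : X ≅ fiberOver f s₁)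
        (A : complexBetti 𝒳 (2 * p)),
        IsSmoothProjectiveFamily f n ∧ IrreducibleSpace S.left ∧ AlgebraicGeometry.Smooth S.hom ∧
        (∀ s : ComplexPoints S, IsRationalClass (complexBetti.map (fiberι f s) (2 * p) A) ∧
          IsOfHodgeType n (fiberOver f s) (2 * p) p p (complexBetti.map (fiberι f s) (2 * p) A)) ∧
        complexBetti.map e.hom (2 * p) (complexBetti.map (fiberι f s₁) (2 * p) A) = c ∧
        complexBetti.map (fiberι f s₀) (2 * p) A ∈ algebraicClasses (fiberOver f s₀) p) →
    AnchorExistence := by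
  intro hK3 hAb hres
  refine anchorExistence_of_k3Square_of_offK3Square hK3 ?_
  intro n X hX hK3X p hp2 hpn c hc hpp halg
  by_cases hAbX : ∃ A : AbelianVariety ℂ, Nonempty (X ≅ A.X)
  · -- abelian variety: `n = A.dim`; anchor `(A.X, (g⁻¹)^* c)` and transport along `g`
    obtain ⟨A, ⟨g⟩⟩ := hAbX
    have hA : IsSmoothProjective A.dim A.X := AbelianVariety.isSmoothProjective_holds
    obtain rfl : n = A.dim := anchorExistenceSplit_dim_eq_of_iso hX hA g
    have h := hAb A p (complexBetti.map g.inv (2 * p) c) (hc.map _) (hpp.map_of_iso g.symm)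
    have h' := anchorTransport_anchor_map_of_iso (n := A.dim) g h
    have hid : complexBetti.map g.hom (2 * p) (complexBetti.map g.inv (2 * p) c) = c := by
      change (complexBetti.map g.inv (2 * p) ≫ complexBetti.map g.hom (2 * p)) c = c
      rw [← complexBetti.map_comp, Iso.hom_inv_id, complexBetti.map_id]
      rfl
    rwa [hid] at h'
  · -- residual sector
    exact hres hX hK3X (fun A => ⟨fun g => hAbX ⟨A, ⟨g⟩⟩⟩) p hp2 hpn c hc hpp halg

/-- **The three-sector split is lossless**: `AnchorExistence` is EQUIVALENT to the conjunction of its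
K3-square, abelian and residual sectors — each sector is an instance of the crux (a K3 square is smooth
projective of dimension `4`, `IsK3Surface.isSmoothProjective_tensor_self`; an abelian variety is smooth
projective of dimension `A.dim`, `AbelianVariety.isSmoothProjective_holds`; the residual is the crux
with its extra hypotheses forgotten), and the converse is
`anchorExistence_of_k3Square_of_abelian_of_residual`. [cite: Deligne2000, §1] -/
theorem anchorExistence_iff_k3Square_and_abelian_and_residual :
    AnchorExistence ↔
      ((∀ S : SchemeOver ℂ, IsK3Surface S →
        ∀ c : complexBetti (S ⊗ S) (2 * 2), IsRationalClass c → IsOfHodgeType 4 (S ⊗ S) (2 * 2) 2 2 c →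
        ∃ (𝒳 B : SchemeOver ℂ) (f : 𝒳 ⟶ B) (s₁ s₀ : ComplexPoints B) (e : S ⊗ S ≅ fiberOver f s₁)
          (A : complexBetti 𝒳 (2 * 2)),
          IsSmoothProjectiveFamily f 4 ∧ IrreducibleSpace B.left ∧ AlgebraicGeometry.Smooth B.hom ∧
          (∀ s : ComplexPoints B, IsRationalClass (complexBetti.map (fiberι f s) (2 * 2) A) ∧
            IsOfHodgeType 4 (fiberOver f s) (2 * 2) 2 2 (complexBetti.map (fiberι f s) (2 * 2) A)) ∧
          complexBetti.map e.hom (2 * 2) (complexBetti.map (fiberι f s₁) (2 * 2) A) = c ∧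
          complexBetti.map (fiberι f s₀) (2 * 2) A ∈ algebraicClasses (fiberOver f s₀) 2) ∧
      (∀ (A : AbelianVariety ℂ) (p : ℕ) (c : complexBetti A.X (2 * p)), IsRationalClass c →
        IsOfHodgeType A.dim A.X (2 * p) p p c →
        ∃ (𝒳 S : SchemeOver ℂ) (f : 𝒳 ⟶ S) (s₁ s₀ : ComplexPoints S) (e : A.X ≅ fiberOver f s₁)
          (B : complexBetti 𝒳 (2 * p)),
          IsSmoothProjectiveFamily f A.dim ∧ IrreducibleSpace S.left ∧ AlgebraicGeometry.Smooth S.hom ∧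
          (∀ s : ComplexPoints S, IsRationalClass (complexBetti.map (fiberι f s) (2 * p) B) ∧
            IsOfHodgeType A.dim (fiberOver f s) (2 * p) p p (complexBetti.map (fiberι f s) (2 * p) B)) ∧
          complexBetti.map e.hom (2 * p) (complexBetti.map (fiberι f s₁) (2 * p) B) = c ∧
          complexBetti.map (fiberι f s₀) (2 * p) B ∈ algebraicClasses (fiberOver f s₀) p) ∧
      (∀ ⦃n : ℕ⦄ ⦃X : SchemeOver ℂ⦄, IsSmoothProjective n X →
        (∀ S : SchemeOver ℂ, IsK3Surface S → IsEmpty (X ≅ S ⊗ S)) →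
        (∀ A : AbelianVariety ℂ, IsEmpty (X ≅ A.X)) →
        ∀ (p : ℕ), 2 ≤ p → p + 2 ≤ n →
        ∀ (c : complexBetti X (2 * p)), IsRationalClass c → IsOfHodgeType n X (2 * p) p p c →
        c ∉ algebraicClasses X p →
        ∃ (𝒳 S : SchemeOver ℂ) (f : 𝒳 ⟶ S) (s₁ s₀ : ComplexPoints S) (e : X ≅ fiberOver f s₁)
          (A : complexBetti 𝒳 (2 * p)),
          IsSmoothProjectiveFamily f n ∧ IrreducibleSpace S.left ∧ AlgebraicGeometry.Smooth S.hom ∧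
          (∀ s : ComplexPoints S, IsRationalClass (complexBetti.map (fiberι f s) (2 * p) A) ∧
            IsOfHodgeType n (fiberOver f s) (2 * p) p p (complexBetti.map (fiberι f s) (2 * p) A)) ∧
          complexBetti.map e.hom (2 * p) (complexBetti.map (fiberι f s₁) (2 * p) A) = c ∧
          complexBetti.map (fiberι f s₀) (2 * p) A ∈ algebraicClasses (fiberOver f s₀) p)) := by
  refine ⟨fun h => ⟨fun S hS c hc hpp => ?_, fun A p c hc hpp => ?_,
      fun _ _ hX _ _ p _ _ c hc hpp _ => ?_⟩,
    fun h => anchorExistence_of_k3Square_of_abelian_of_residual h.1 h.2.1 h.2.2⟩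
  · -- the K3-square sector is the instance `n = 4`, `X = S ⊗ S`, `p = 2` of the crux
    exact h hS.isSmoothProjective_tensor_self 2 c hc hpp
  · -- the abelian sector is the instance `n = A.dim`, `X = A.X` of the crux
    exact h AbelianVariety.isSmoothProjective_holds p c hc hpp
  · -- the residual is the crux with its extra hypotheses forgotten
    exact h hX p c hc hpp

end Summit.HodgeConjecture.HodgeConjecture.Theorems

end
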